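import Mathlib
import Summits.NavierStokesRegularity.NavierStokesRegularity.Theorems.TaoLadderRungThreeRestartControl
import Summits.NavierStokesRegularity.NavierStokesRegularity.Theses.TaoLadderRungTwoPoly
import HarnessLib

/-!
# `TaoLadderRungTwoPoly.RestartControl` (item stmt-NavierStokesRegularity-20650)

The support `RestartControl` of route `TaoLadderRungTwoPoly` is, character for character, the
shared support `RestartControl` of routes `TaoLadderRungThree` / `TaoLadderRungTwo`
(item stmt-NavierStokesRegularity-20424), already proved in the tree as
`Theorems.RestartControl.main` (file `TaoLadderRungThreeRestartControl.lean`): Tao's scale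
covariance at a checkpoint — the family restarted at checkpoint `(N, t_N, e_N)` of a local
pseudo-solution is an `(η, η)`-`PseudoFlowOn` from the rescaled checkpoint state with admissible
slack `restartSlack ≤ η · slackWeight`. This file closes the new item by that theorem.

HONEST FRAMING: bookkeeping about Tao-type MODEL lattice pseudo-flows (Tao 2016 §6.4); nothing
here is a statement about the Navier–Stokes equations, and the route's rung leaf is not the summit
Statement.
-/

noncomputable section

set_option linter.dupNamespace false

namespace Summit.NavierStokesRegularity.NavierStokesRegularity.Theorems

open RestartControl in
/-- **Item stmt-NavierStokesRegularity-20650** (`TaoLadderRungTwoPoly.RestartControl`): Tao's scale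
covariance at a checkpoint with small defects and admissible slack — the statement of the shared
support stmt-NavierStokesRegularity-20424 read in route `TaoLadderRungTwoPoly`, closed by the tree
theorem `RestartControl.main`. [cite: Tao2016AveragedNS, §6.4 Prop. 6.5 and Lemma 6.7] -/
theorem taoLadderRungTwoPoly_restartControl_proof :
    Summit.NavierStokesRegularity.NavierStokesRegularity.Theses.TaoLadderRungTwoPoly.RestartControl := by
  unfold Summit.NavierStokesRegularity.NavierStokesRegularity.Theses.TaoLadderRungTwoPoly.RestartControl
  intro ε₀ θ c η i₀ α X₀ P env K₁ K₂ hε₀ hθ hc hη hX₀ hK₁ hK₂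
  exact main hε₀ hθ hc hη hX₀ hK₁ hK₂

end Summit.NavierStokesRegularity.NavierStokesRegularity.Theorems

end
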